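import Literature.NumberTheory.EllipticCurves.Cm7OrbitIntegrality
import Literature.NumberTheory.EllipticCurves.DeShalit1987.RayClassFieldPAdicReading
import Literature.NumberTheory.EllipticCurves.CMTransformationPairSeven
import Literature.NumberTheory.EllipticCurves.DivisionPointsKernelMembership
import Literature.NumberTheory.EllipticCurves.WeierstrassAdditionProofs
import HarnessLib

/-!
# RP-INT part 2: the `𝔓`-integrality hypotheses of `exists_thetaDatum_readingRing`, discharged from the CM orbit
# (de Shalit II §4.9 (i); proofs only)

Cell `bsd-print-cf2`, width seat `bsd-line-cf2-p1-w7` g16 (LEAD R-RP-INT); `--supports` stmt-BirchSwinnertonDyer-24720 (helper, Theses-free).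
THEOREMS ONLY; no `def`, no named fact, no `sorry`.

WHAT.  `KatzMeasureJZeroSeam.exists_thetaDatum_readingRing` ((RP)-THETA-DATUM part 2) takes as HYPOTHESES the `𝔓`-integrality of the algebraic
model coordinates `X = ℘(z) + ¼`, `Y = (℘′(z) − X)/2` of the division points `ξ(z)` it reads (`X ∈ readingRing E hE`, i.e. `‖e X‖ ≤ 1`).  THIS
FILE proves them for every `z` whose CM orbit `π₀ᵏz (mod L)` avoids `L` and is periodic — every division point of order prime to `𝔭 = (π₀)`,
in particular the `𝔪`-, `𝔞`- and `𝔪𝔞`-division points of the seam (`(𝔪𝔞, 𝔭) = 1`; the even part `v̄^{M+1}` of `𝔪` is allowed):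
* §1 `recursion_seven` — the VALUE identity `X(π₀z)·(4X(z) + 3 − w) = (−1 − w)X(z)² + (2w − 2)` (`w = ι π₀`, `w² = w − 2`) from
  `CMTransformationPairSeven.transformation_seven_model` (the re-centred pair `Q̂ = 4X + 3 − w`, `P̂ = (−1−w)X² + 2w − 2`);
* §2 ★★ `mem_readingRing_of_orbit` — **`X(z) ∈ readingRing E hE`**: the identity pulled back to `K(𝔪_r)` along the injective `ι̂`, pushed into
  `E` by `e|_{K(𝔪_r)}`, and `Cm7Orbit.val_le_one_of_orbit` (growth `|X_{k+1}| > |X_k|` once `|X_0| > 1`, against the periodicity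
  `X_n = X_0`); inputs `‖2‖_E < 1`, `‖e(π₀)‖_E < 1` (the lane's `π₀ = u·2`);
* §4 ★ `norm_sub_eq_one_of_readings` — **`‖x(ξΩ) − x(ξc)‖ = 1`** on the lane curve (`Cm7Orbit.val_sub_eq_one_of_isIntegralPoint`: reduction
  mod `𝔪`, with `ξΩ ∓ ξc = ξ(Ω ∓ c)` from `DivisionPointsOnLaneCurve` and `℘(Ω) ≠ ℘(c)`).
* §3 ★ `mem_readingRing_of_orbit_y` — **`Y(z) ∈ readingRing E hE`** (`y² + xy = x³ − x² − 2x − 1` from `℘′² = 4℘³ − g₂℘ − g₃` at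
  `(g₂, g₃) = (35/4, 49/8)`, then `Cm7Kernel.val_y_le_one`).

HONEST FRAMING: plumbing of accepted kernel theorems; nothing is closed; no summit statement is proved by this seat; BSD is not proved by any of this.

## References
* [deShalit1987] E. de Shalit, *Iwasawa theory of elliptic curves with complex multiplication* (1987), II §1.10 (p. 39), II §4.9 (i) (p. 62–63).
* [SilvermanAEC2009] J. H. Silverman, *The Arithmetic of Elliptic Curves*, 2nd ed. (2009), VI.3.6, VII.2.2, VII.3.1.
-/

-- the summit namespace `Summit.BirchSwinnertonDyer.BirchSwinnertonDyer` repeats the problem name by design (D-0017)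
set_option linter.dupNamespace false
set_option autoImplicit false

noncomputable section

open scoped Classical NNReal
open scoped NumberField PeriodPair
open PeriodPair Literature.NumberTheory.EllipticCurves Literature.NumberTheory.EllipticCurves.DeShalit1987
open NumberField Field IsDedekindDomain IsDedekindDomain.HeightOneSpectrum ValuativeRel
open Literature.NumberTheory.NumberFields Literature.NumberTheory.ComplexMultiplication.EllipticUnits
open Literature.NumberTheory.GaloisRepresentations Literature.NumberTheory.GaloisRepresentations.IsNonarchimedeanLocalField
  Literature.NumberTheory.GaloisRepresentations.LubinTate
open Polynomial Literature.NumberTheory.EllipticCurves.FormalGroupChart _root_.WeierstrassCurve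

namespace Summit.BirchSwinnertonDyer.BirchSwinnertonDyer.Theorems.PrintCf2.KatzMeasureJZeroSeam

attribute [local instance] ltNormUniformSpace ltNormIsUniformAddGroup rk1 nF nE fintypeResidueField

/-! ## §1 The value identity along the CM orbit -/

/-- **`X(wz)·(4X(z) + 3 − w) = (−1 − w)X(z)² + (2w − 2)`** for the model coordinate `X = ℘ + ¼` of the lattice with `(g₂, g₃) = (35/4, 49/8)`,
`w² = w − 2`, `z, wz ∉ Λ` — `−1/16` times the transformation identity `P_Λ(℘ z) = ℘(wz)·Q_Λ(℘ z)`. [cite: deShalit1987, II §1.10 (p. 39)]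
[cite: SilvermanAEC2009, VI.3.6] -/
theorem recursion_seven {w : ℂ} (hw : w ^ 2 = w - 2) (L : PeriodPair) (hg₂ : L.g₂ = 35 / 4) (hg₃ : L.g₃ = 49 / 8) {z : ℂ}
    (hz : z ∉ L.lattice) (hwz : w * z ∉ L.lattice) :
    (℘[L] (w * z) + 1 / 4) * (4 * (℘[L] z + 1 / 4) + 3 - w) = (-1 - w) * (℘[L] z + 1 / 4) ^ 2 + (2 * w - 2) := by
  have hT := transformation_seven_model hw L hg₂ hg₃ z hz hwz
  simp only [eval_add, eval_mul, eval_C, eval_X, eval_pow] at hT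
  linear_combination (-1 / 16 : ℂ) * hT

/-- The model equation `Y² + XY = X³ − X² − 2X − 1` for `X = ℘ + ¼`, `Y = (℘′ − X)/2` at `(g₂, g₃) = (35/4, 49/8)`.
[cite: SilvermanAEC2009, VI.3.6] -/
theorem equation_seven (L : PeriodPair) (hg₂ : L.g₂ = 35 / 4) (hg₃ : L.g₃ = 49 / 8) {z : ℂ} (hz : z ∉ L.lattice) :
    ((℘'[L] z - (℘[L] z + 1 / 4)) / 2) ^ 2 + (℘[L] z + 1 / 4) * ((℘'[L] z - (℘[L] z + 1 / 4)) / 2) =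
      (℘[L] z + 1 / 4) ^ 3 - (℘[L] z + 1 / 4) ^ 2 - 2 * (℘[L] z + 1 / 4) - 1 := by
  have hsq := L.derivWeierstrassP_sq z hz
  rw [hg₂, hg₃] at hsq
  linear_combination (1 / 4 : ℂ) * hsq

/-! ## §2 `X(z) ∈ readingRing E hE` from the orbit -/

variable {K : Type} [Field K] [NumberField K] {v : HeightOneSpectrum (𝓞 K)} {𝔪r : Ideal (𝓞 K)}

/-- ★★ **The model `x`-coordinate of a division point whose CM orbit avoids `L` and is periodic is `𝔓`-integral** (de Shalit II §4.9 (i)):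
for `z` with `π₀ᵏz ∉ L` for all `k` and `π₀ⁿz ≡ z (mod L)` for some `n > 0`, and algebraic elements `X_k ∈ K(𝔪_r)` with
`ι̂ X_k = ℘(π₀ᵏz) + ¼`, the element `X_0` lies in the reading ring (`‖e X_0‖ ≤ 1`).  Inputs at `E`: `‖2‖ < 1` and `‖e(π₀)‖ < 1`.
[cite: deShalit1987, II §4.9 (i) (p. 62–63)] [cite: SilvermanAEC2009, VII.2.2] -/
theorem mem_readingRing_of_orbit (ι : K →+* ℂ)
    (E : IntermediateField (v.adicCompletion K) (AlgebraicClosure (v.adicCompletion K)))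
    [FiniteDimensional (v.adicCompletion K) E]
    (hE : ∀ y : AlgebraicClosure K, y ∈ rayClassField K 𝔪r → absClosureEmbedding K (v.adicCompletion K) y ∈ E)
    {π₀ : K} (hw : ι π₀ ^ 2 = ι π₀ - 2) (h2E : ‖(2 : E)‖ < 1)
    (hπE : ‖(readingFieldHom E hE (algebraMap K (rayClassField K 𝔪r) π₀) : E)‖ < 1)
    (L : PeriodPair) (hg₂ : L.g₂ = 35 / 4) (hg₃ : L.g₃ = 49 / 8)
    {z : ℂ} (horb : ∀ k : ℕ, ι π₀ ^ k * z ∉ L.lattice) {n : ℕ} (hn : 0 < n) (hper : ι π₀ ^ n * z - z ∈ L.lattice)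
    (X : ℕ → rayClassField K 𝔪r) (hX : ∀ k, algClosureEmb ι (X k) = ℘[L] (ι π₀ ^ k * z) + 1 / 4) :
    X 0 ∈ readingRing E hE := by
  -- the injective complex reading `φ = ι̂ ∘ (K(𝔪r) ⊂ K̄)`
  have hφ : Function.Injective ((algClosureEmb ι).comp (algebraMap (rayClassField K 𝔪r) (AlgebraicClosure K))) :=
    (algClosureEmb ι).injective.comp (algebraMap (rayClassField K 𝔪r) (AlgebraicClosure K)).injective
  have hφX : ∀ k, ((algClosureEmb ι).comp (algebraMap (rayClassField K 𝔪r) (AlgebraicClosure K))) (X k) =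
      ℘[L] (ι π₀ ^ k * z) + 1 / 4 := fun k ↦ hX k
  have hφπ : ((algClosureEmb ι).comp (algebraMap (rayClassField K 𝔪r) (AlgebraicClosure K)))
      (algebraMap K (rayClassField K 𝔪r) π₀) = ι π₀ := by
    rw [RingHom.comp_apply, ← IsScalarTower.algebraMap_apply, algClosureEmb_algebraMap]
  -- §1 read in `ℂ`, pulled back to `K(𝔪r)`
  have hrecF : ∀ k, X (k + 1) * (4 * X k + 3 - algebraMap K (rayClassField K 𝔪r) π₀) =
      (-1 - algebraMap K (rayClassField K 𝔪r) π₀) * X k ^ 2 + (2 * algebraMap K (rayClassField K 𝔪r) π₀ - 2) := by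
    intro k
    apply hφ
    have hz : ι π₀ ^ k * z ∉ L.lattice := horb k
    have hwz : ι π₀ * (ι π₀ ^ k * z) ∉ L.lattice := by rw [← mul_assoc, ← pow_succ']; exact horb (k + 1)
    have h := recursion_seven hw L hg₂ hg₃ hz hwz
    rw [← mul_assoc, ← pow_succ'] at h
    simp only [map_mul, map_add, map_sub, map_pow, map_neg, map_one, map_ofNat, hφX, hφπ]
    exact h
  -- periodicity `X_n = X_0`
  have hXn : X 0 = X n := by
    apply hφ
    rw [hφX, hφX, pow_zero, one_mul]
    have e1 : ι π₀ ^ n * z = z + ((⟨ι π₀ ^ n * z - z, hper⟩ : L.lattice) : ℂ) := by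
      change ι π₀ ^ n * z = z + (ι π₀ ^ n * z - z); ring
    rw [e1, L.weierstrassP_add_coe]
  -- push into `E` and run the orbit argument for the valuation `‖·‖`
  have hrecE : ∀ k, (readingFieldHom E hE (X (k + 1)) : E) *
      (4 * (readingFieldHom E hE (X k) : E) + 3 - readingFieldHom E hE (algebraMap K (rayClassField K 𝔪r) π₀)) =
      (-1 - readingFieldHom E hE (algebraMap K (rayClassField K 𝔪r) π₀)) * (readingFieldHom E hE (X k) : E) ^ 2 +
        (2 * readingFieldHom E hE (algebraMap K (rayClassField K 𝔪r) π₀) - 2) := by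
    intro k
    have h := congrArg (readingFieldHom E hE) (hrecF k)
    simp only [map_mul, map_add, map_sub, map_pow, map_neg, map_one, map_ofNat] at h
    exact h
  have h2w : NormedField.valuation (2 : E) < 1 := by
    change ‖(2 : E)‖₊ < 1; exact_mod_cast h2E
  have hπw : NormedField.valuation (readingFieldHom E hE (algebraMap K (rayClassField K 𝔪r) π₀) : E) < 1 := by
    change ‖(readingFieldHom E hE (algebraMap K (rayClassField K 𝔪r) π₀) : E)‖₊ < 1; exact_mod_cast hπE
  have hle := Cm7Orbit.val_le_one_of_orbit (w := NormedField.valuation (K := E)) h2w hπw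
    (X := fun k ↦ (readingFieldHom E hE (X k) : E)) hrecE hn (congrArg (fun y ↦ (readingFieldHom E hE y : E)) hXn)
  rw [mem_readingRing_iff]
  have : ‖(readingFieldHom E hE (X 0) : E)‖₊ ≤ 1 := hle
  exact_mod_cast this

/-! ## §3 `Y(z) ∈ readingRing E hE` -/

/-- ★ **The model `y`-coordinate is `𝔓`-integral as well**: if `ι̂ X = ℘(z) + ¼`, `ι̂ Y = (℘′(z) − (℘(z) + ¼))/2` and `X ∈ readingRing E hE`,
then `Y ∈ readingRing E hE` (`y² + xy = x³ − x² − 2x − 1`, `Cm7Kernel.val_y_le_one`). [cite: deShalit1987, II §4.9 (i) (p. 62–63)]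
[cite: SilvermanAEC2009, VII.2.2] -/
theorem mem_readingRing_of_orbit_y (ι : K →+* ℂ)
    (E : IntermediateField (v.adicCompletion K) (AlgebraicClosure (v.adicCompletion K)))
    [FiniteDimensional (v.adicCompletion K) E]
    (hE : ∀ y : AlgebraicClosure K, y ∈ rayClassField K 𝔪r → absClosureEmbedding K (v.adicCompletion K) y ∈ E)
    (h2E : ‖(2 : E)‖ < 1) (L : PeriodPair) (hg₂ : L.g₂ = 35 / 4) (hg₃ : L.g₃ = 49 / 8) {z : ℂ} (hz : z ∉ L.lattice)
    {X Y : rayClassField K 𝔪r} (hX : algClosureEmb ι X = ℘[L] z + 1 / 4)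
    (hY : algClosureEmb ι Y = (℘'[L] z - (℘[L] z + 1 / 4)) / 2) (hXi : X ∈ readingRing E hE) :
    Y ∈ readingRing E hE := by
  have hφ : Function.Injective ((algClosureEmb ι).comp (algebraMap (rayClassField K 𝔪r) (AlgebraicClosure K))) :=
    (algClosureEmb ι).injective.comp (algebraMap (rayClassField K 𝔪r) (AlgebraicClosure K)).injective
  have heqF : Y ^ 2 + X * Y = X ^ 3 - X ^ 2 - 2 * X - 1 := by
    apply hφ
    simp only [map_mul, map_add, map_sub, map_pow, map_one, map_ofNat]
    change algClosureEmb ι Y ^ 2 + algClosureEmb ι X * algClosureEmb ι Y =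
      algClosureEmb ι X ^ 3 - algClosureEmb ι X ^ 2 - 2 * algClosureEmb ι X - 1
    rw [hX, hY]
    exact equation_seven L hg₂ hg₃ hz
  have heqE : (readingFieldHom E hE Y : E) ^ 2 + (readingFieldHom E hE X : E) * readingFieldHom E hE Y =
      (readingFieldHom E hE X : E) ^ 3 - (readingFieldHom E hE X : E) ^ 2 - 2 * readingFieldHom E hE X - 1 := by
    have h := congrArg (readingFieldHom E hE) heqF
    simp only [map_mul, map_add, map_sub, map_pow, map_one, map_ofNat] at h
    exact h
  have h2w : NormedField.valuation (2 : E) < 1 := by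
    change ‖(2 : E)‖₊ < 1; exact_mod_cast h2E
  have hxw : NormedField.valuation (readingFieldHom E hE X : E) ≤ 1 := by
    change ‖(readingFieldHom E hE X : E)‖₊ ≤ 1
    exact_mod_cast (mem_readingRing_iff E hE X).mp hXi
  have hyw := Cm7Kernel.val_y_le_one (w := NormedField.valuation (K := E)) h2w heqE hxw
  rw [mem_readingRing_iff]
  have : ‖(readingFieldHom E hE Y : E)‖₊ ≤ 1 := hyw
  exact_mod_cast this


/-! ## §4 The unit `x(ξΩ) − x(ξc)` -/

section Unit

variable {F : Type} [Field F] [ValuativeRel F] [TopologicalSpace F] [IsNonarchimedeanLocalField F]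
  {p : ℕ} [Fact p.Prime] (e : 𝒪[F] ≃+* ℤ_[p]) (M : IntermediateField F (AlgebraicClosure F)) [FiniteDimensional F M]
  {Kb : Type*} [Field Kb] (ιc : Kb →+* ℂ) (ιv : Kb →+* AlgebraicClosure F) (L : PeriodPair)
  (h₂ : L.g₂ = (((⟨1, -1, 0, -2, -1⟩ : WeierstrassCurve ℤ)).baseChange ℂ).c₄ / 12)
  (h₃ : L.g₃ = (((⟨1, -1, 0, -2, -1⟩ : WeierstrassCurve ℤ)).baseChange ℂ).c₆ / 216)

include e h₂ h₃ in
/-- ★ **`‖x(ξΩ) − x(ξc)‖ = 1`** (de Shalit II §4.9 (i): «`℘(Ω) − ℘(v)` is a `𝔓`-unit») for division points `Ω, c` with `Ω ± c ∉ Λ`, read on the lane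
curve over `M` together with `ξ(Ω − c)` and `ξ(Ω + c)`, all four with integral `x`-coordinate (§2): by `Cm7Orbit.val_sub_eq_one_of_isIntegralPoint`
(reduction modulo `𝔪_M`), the group law on readings (`some_sub_some_eq_some_curveOver_of_readings`) and `℘(Ω) ≠ ℘(c)`.
[cite: deShalit1987, II §4.9 (i) (p. 62–63)] [cite: SilvermanAEC2009, Prop. VII.2.1, Prop. VI.3.6 (b)] -/
theorem norm_sub_eq_one_of_readings (h2M : ‖(2 : M)‖ < 1) {Ω c : ℂ} (hΩ : Ω ∉ L.lattice) (hc : c ∉ L.lattice)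
    (hm : Ω - c ∉ L.lattice) (hpl : Ω + c ∉ L.lattice)
    {xΩ yΩ xc yc xm ym xp yp : Kb}
    (hxΩ : ιc xΩ = ℘[L] Ω - (((⟨1, -1, 0, -2, -1⟩ : WeierstrassCurve ℤ)).baseChange ℂ).b₂ / 12)
    (hyΩ : ιc yΩ = (℘'[L] Ω - (((⟨1, -1, 0, -2, -1⟩ : WeierstrassCurve ℤ)).baseChange ℂ).a₁ *
      (℘[L] Ω - (((⟨1, -1, 0, -2, -1⟩ : WeierstrassCurve ℤ)).baseChange ℂ).b₂ / 12) - (((⟨1, -1, 0, -2, -1⟩ : WeierstrassCurve ℤ)).baseChange ℂ).a₃) / 2)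
    (hxc : ιc xc = ℘[L] c - (((⟨1, -1, 0, -2, -1⟩ : WeierstrassCurve ℤ)).baseChange ℂ).b₂ / 12)
    (hyc : ιc yc = (℘'[L] c - (((⟨1, -1, 0, -2, -1⟩ : WeierstrassCurve ℤ)).baseChange ℂ).a₁ *
      (℘[L] c - (((⟨1, -1, 0, -2, -1⟩ : WeierstrassCurve ℤ)).baseChange ℂ).b₂ / 12) - (((⟨1, -1, 0, -2, -1⟩ : WeierstrassCurve ℤ)).baseChange ℂ).a₃) / 2)
    (hxm : ιc xm = ℘[L] (Ω - c) - (((⟨1, -1, 0, -2, -1⟩ : WeierstrassCurve ℤ)).baseChange ℂ).b₂ / 12)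
    (hym : ιc ym = (℘'[L] (Ω - c) - (((⟨1, -1, 0, -2, -1⟩ : WeierstrassCurve ℤ)).baseChange ℂ).a₁ *
      (℘[L] (Ω - c) - (((⟨1, -1, 0, -2, -1⟩ : WeierstrassCurve ℤ)).baseChange ℂ).b₂ / 12) - (((⟨1, -1, 0, -2, -1⟩ : WeierstrassCurve ℤ)).baseChange ℂ).a₃) / 2)
    (hxp : ιc xp = ℘[L] (Ω + c) - (((⟨1, -1, 0, -2, -1⟩ : WeierstrassCurve ℤ)).baseChange ℂ).b₂ / 12)
    (hyp : ιc yp = (℘'[L] (Ω + c) - (((⟨1, -1, 0, -2, -1⟩ : WeierstrassCurve ℤ)).baseChange ℂ).a₁ *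
      (℘[L] (Ω + c) - (((⟨1, -1, 0, -2, -1⟩ : WeierstrassCurve ℤ)).baseChange ℂ).b₂ / 12) - (((⟨1, -1, 0, -2, -1⟩ : WeierstrassCurve ℤ)).baseChange ℂ).a₃) / 2)
    {XΩ YΩ XC YC XM YM XP YP : M}
    (hXΩ : ((XΩ : M) : AlgebraicClosure F) = ιv xΩ) (hYΩ : ((YΩ : M) : AlgebraicClosure F) = ιv yΩ)
    (hXC : ((XC : M) : AlgebraicClosure F) = ιv xc) (hYC : ((YC : M) : AlgebraicClosure F) = ιv yc)
    (hXM : ((XM : M) : AlgebraicClosure F) = ιv xm) (hYM : ((YM : M) : AlgebraicClosure F) = ιv ym)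
    (hXP : ((XP : M) : AlgebraicClosure F) = ιv xp) (hYP : ((YP : M) : AlgebraicClosure F) = ιv yp)
    (hiΩ : ‖XΩ‖ ≤ 1) (hic : ‖XC‖ ≤ 1) (him : ‖XM‖ ≤ 1) (hip : ‖XP‖ ≤ 1) :
    ‖XΩ - XC‖ = 1 := by
  have hnΩ := nonsingular_curveOver_of_readings e M _ ιc ιv L h₂ h₃ hΩ hxΩ hyΩ hXΩ hYΩ
  have hnc := nonsingular_curveOver_of_readings e M _ ιc ιv L h₂ h₃ hc hxc hyc hXC hYC
  have hnm := nonsingular_curveOver_of_readings e M _ ιc ιv L h₂ h₃ hm hxm hym hXM hYM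
  have hnp := nonsingular_curveOver_of_readings e M _ ιc ιv L h₂ h₃ hpl hxp hyp hXP hYP
  -- `ξΩ − ξc = ξ(Ω − c)` and `ξΩ + ξc = ξ(Ω + c)` on the lane curve
  have hsub := some_sub_some_eq_some_curveOver_of_readings (dec := (inferInstance : DecidableEq M)) e M _ ιc ιv L h₂ h₃
    hm hc hΩ (by ring) hxm hym hxc hyc hxΩ hyΩ
    hXM hYM hXC hYC hXΩ hYΩ hnm hnc hnΩ
  have hadd' := some_sub_some_eq_some_curveOver_of_readings (dec := (inferInstance : DecidableEq M)) e M _ ιc ιv L h₂ h₃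
    hΩ hc hpl (by ring) hxΩ hyΩ hxc hyc hxp hyp
    hXΩ hYΩ hXC hYC hXP hYP hnΩ hnc hnp
  -- `x`-coordinates distinct: `℘(Ω) ≠ ℘(c)`
  have hxne : XΩ ≠ XC := by
    intro h
    have h1 : ιv xΩ = ιv xc := by rw [← hXΩ, ← hXC, h]
    have h2 : xΩ = xc := ιv.injective h1
    have h3 : ℘[L] Ω = ℘[L] c := by
      have := congrArg ιc h2; rw [hxΩ, hxc] at this; exact sub_left_injective this
    rcases (L.weierstrassP_eq_weierstrassP_iff hΩ hc).mp h3 with h4 | h4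
    · exact hpl h4
    · exact hm h4
  have hne : (.some XΩ YΩ hnΩ : (curveOver M (((⟨1, -1, 0, -2, -1⟩ : WeierstrassCurve ℤ).map (Int.castRingHom ℤ_[p])).map
      ((LTCoeff.of F).toRingHom.comp e.symm.toRingHom))).toAffine.Point) ≠ .some XC YC hnc := fun h ↦
    hxne (WeierstrassCurve.Affine.Point.some.inj h).1
  have hne' : (.some XΩ YΩ hnΩ : (curveOver M (((⟨1, -1, 0, -2, -1⟩ : WeierstrassCurve ℤ).map (Int.castRingHom ℤ_[p])).map
      ((LTCoeff.of F).toRingHom.comp e.symm.toRingHom))).toAffine.Point) ≠ -.some XC YC hnc := fun h ↦ by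
    rw [WeierstrassCurve.Affine.Point.neg_some] at h
    exact hxne (WeierstrassCurve.Affine.Point.some.inj h).1
  -- reduction: `|x(P) − x(Q)| = 1`
  have h2w : NormedField.valuation (2 : M) < 1 := by
    change ‖(2 : M)‖₊ < 1; exact_mod_cast h2M
  have hΔ := Cm7Orbit.val_Δ_cm7 (w := NormedField.valuation (K := M)) (cm7_lane_a e M) h2w
  have hwΩ : NormedField.valuation (XΩ : M) ≤ 1 := by change ‖XΩ‖₊ ≤ 1; exact_mod_cast hiΩ
  have hwc : NormedField.valuation (XC : M) ≤ 1 := by change ‖XC‖₊ ≤ 1; exact_mod_cast hic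
  have hadd : (.some XΩ YΩ hnΩ : (curveOver M (((⟨1, -1, 0, -2, -1⟩ : WeierstrassCurve ℤ).map (Int.castRingHom ℤ_[p])).map
      ((LTCoeff.of F).toRingHom.comp e.symm.toRingHom))).toAffine.Point) + .some XC YC hnc = .some XP YP hnp := by
    rw [← hadd', sub_add_cancel]
  have hwm : IsIntegralPoint (NormedField.valuation (K := M))
      ((.some XΩ YΩ hnΩ : (curveOver M (((⟨1, -1, 0, -2, -1⟩ : WeierstrassCurve ℤ).map (Int.castRingHom ℤ_[p])).map
        ((LTCoeff.of F).toRingHom.comp e.symm.toRingHom))).toAffine.Point) - .some XC YC hnc) := by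
    rw [hsub]; change ‖XM‖₊ ≤ 1; exact_mod_cast him
  have hwp : IsIntegralPoint (NormedField.valuation (K := M))
      ((.some XΩ YΩ hnΩ : (curveOver M (((⟨1, -1, 0, -2, -1⟩ : WeierstrassCurve ℤ).map (Int.castRingHom ℤ_[p])).map
        ((LTCoeff.of F).toRingHom.comp e.symm.toRingHom))).toAffine.Point) + .some XC YC hnc) := by
    rw [hadd]; change ‖XP‖₊ ≤ 1; exact_mod_cast hip
  have key := Cm7Orbit.val_sub_eq_one_of_isIntegralPoint (w := NormedField.valuation (K := M)) hΔ hwΩ hwc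
    (by convert hwm) (by convert hwp) hne hne'
  have h1 : (‖XΩ - XC‖₊ : ℝ≥0) = 1 := key
  rw [← coe_nnnorm, h1, NNReal.coe_one]

end Unit

end Summit.BirchSwinnertonDyer.BirchSwinnertonDyer.Theorems.PrintCf2.KatzMeasureJZeroSeam

end
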